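import Summits.ResolutionOfSingularities.ResolutionOfSingularities.Theses.PAlteration

/-!
# `PicoverToRadicialBottom` — support lemmas: certifying radicial (universally injective) covers

Support lemmas for crux `stmt-ResolutionOfSingularities-0556`
(`Summit.ResolutionOfSingularities.ResolutionOfSingularities.Theses.PAlteration.PicoverToRadicialBottom`)
and its antecedent `Picover`, filed by the standing disprover (cdisprove gen 1; work file
`Cruxes/PicoverToRadicialBottom/Disproof.lean`; companions `Negative/LoadBearing.lean`,
`Negative/RegularityNotDescending.lean`). Both the crux's consequent and `Picover` carry the
hypothesis `AlgebraicGeometry.UniversallyInjective g`; this file gives kernel-checked CRITERIA that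
discharge it for the covers the route is about, and certifies the witness cover used by
`RegularityNotDescending.lean`. No definition, no notation; no Theses decl is concluded.

* `universallyInjective_SpecMap_of_ideal_le_nilradical` — `Spec S → Spec R` is universally
  injective as soon as the kernel of `S ⊗_R S → S` is nil (the diagonal is then a surjective closed
  immersion; Mathlib `UniversallyInjective.iff_diagonal`, `diagonal_SpecMap`).
* `tmul_sub_pow_three_eq_zero`, `kaehlerIdeal_le_nilradical_of_adjoin_singleton` — if `S = A[s]`
  then the kernel is generated by `1 ⊗ s − s ⊗ 1` up to the subalgebra trick, so ONE nilpotent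
  `1 ⊗ s − s ⊗ 1` makes the whole kernel nil; and `s², s³ ∈ A ⇒ (1 ⊗ s − s ⊗ 1)³ = 0`
  (`a = s ⊗ 1`, `b = 1 ⊗ s`: `a² = b²`, `a³ = b³`, `(b − a)³ = (3a + 3b)(a² − b²) − 4(a³ − b³)`).
* `universallyInjective_SpecMap_of_pow_char_mem_range`,
  `universallyInjective_SpecMap_adjoinRoot_X_pow_char_sub_C` — in characteristic `p`,
  `Spec B[s] → Spec B` with `s^p ∈ B` is universally injective (`(1 ⊗ s − s ⊗ 1)^p =
  1 ⊗ s^p − s^p ⊗ 1 = 0`); in particular the `α_p`-cover `Spec B[t]/(t^p − f) → Spec B` over a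
  domain `B` (the shape of `PicoverLocalModel`, stmt-0557, and of the generic finite radicial cover
  of a regular variety, Temkin 2013 Rem. 1.3.5 (ii)).
* `universallyInjective_cuspNormalization`, `isFinite_cuspNormalization`,
  `surjective_cuspNormalization` — the normalisation `Spec K[T] → Spec K[T², T³]` of the cuspidal
  cubic is finite, surjective and universally injective over any field (`T` integral, `T², T³`
  scalars): the witness cover of `RegularityNotDescending.lean`.

## Sources
* The Stacks Project, Tag 01S4 (universally injective ⇔ diagonal surjective ⇔ radicial).
* M. Temkin, *Inseparable local uniformization*, J. Algebra 373 (2013), Rem. 1.3.5 (ii) (the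
  `α_p`-torsor model `t^p = a`), context only. Folklore otherwise.
-/

noncomputable section

open CategoryTheory CategoryTheory.Limits AlgebraicGeometry TensorProduct Polynomial
open Literature.AlgebraicGeometry.Resolution

set_option linter.dupNamespace false

namespace Summit.ResolutionOfSingularities.ResolutionOfSingularities.Theorems.PicoverToRadicialBottom.Negative

/-- **UI criterion.** `Spec S → Spec R` is universally injective as soon as the kernel of the
multiplication `S ⊗_R S → S` is nil: then the diagonal (a closed immersion cut out by that kernel)
is surjective. [cite: StacksProject, Tag 01S4] -/
theorem universallyInjective_SpecMap_of_ideal_le_nilradical (R S : Type) [CommRing R] [CommRing S]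
    [Algebra R S] (h : KaehlerDifferential.ideal R S ≤ nilradical (S ⊗[R] S)) :
    UniversallyInjective (Spec.map (CommRingCat.ofHom (algebraMap R S))) := by
  rw [UniversallyInjective.iff_diagonal, diagonal_SpecMap]
  haveI : Surjective (Spec.map (CommRingCat.ofHom
      (Algebra.TensorProduct.lmul' R : S ⊗[R] S →ₐ[R] S).toRingHom)) := by
    refine ⟨fun x => ?_⟩
    have hsurj : Function.Surjective
        (Algebra.TensorProduct.lmul' R : S ⊗[R] S →ₐ[R] S).toRingHom := fun s =>
      ⟨s ⊗ₜ[R] 1, by simp⟩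
    let x' : PrimeSpectrum (S ⊗[R] S) := x
    have hx : x' ∈ Set.range (PrimeSpectrum.comap
        (Algebra.TensorProduct.lmul' R : S ⊗[R] S →ₐ[R] S).toRingHom) := by
      rw [range_comap_of_surjective _ _ hsurj, PrimeSpectrum.mem_zeroLocus]
      intro z hz
      have hz' : z ∈ KaehlerDifferential.ideal R S := by
        simpa [RingHom.mem_ker] using hz
      exact nilradical_le_prime x'.asIdeal (h hz')
    obtain ⟨y, hy⟩ := hx
    exact ⟨y, hy⟩
  infer_instance

/-- `(1 ⊗ s − s ⊗ 1)³ = 0` in `S ⊗_A S` as soon as `s²` and `s³` are scalars from `A`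
(`a = s ⊗ 1`, `b = 1 ⊗ s`: `a² = b²`, `a³ = b³`, and `(b − a)³ = (3a + 3b)(a² − b²) − 4(a³ − b³)`).
[folklore] -/
theorem tmul_sub_pow_three_eq_zero (A S : Type) [CommRing A] [CommRing S] [Algebra A S] (s : S)
    (h2 : s ^ 2 ∈ Set.range (algebraMap A S)) (h3 : s ^ 3 ∈ Set.range (algebraMap A S)) :
    ((1 : S) ⊗ₜ[A] s - s ⊗ₜ[A] (1 : S)) ^ 3 = 0 := by
  obtain ⟨r2, hr2⟩ := h2
  obtain ⟨r3, hr3⟩ := h3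
  have key : ∀ (m : ℕ) (r : A), algebraMap A S r = s ^ m →
      (s ⊗ₜ[A] (1 : S)) ^ m = ((1 : S) ⊗ₜ[A] s) ^ m := by
    intro m r hr
    rw [Algebra.TensorProduct.tmul_pow, Algebra.TensorProduct.tmul_pow]
    simp only [one_pow]
    rw [← hr, Algebra.algebraMap_eq_smul_one, TensorProduct.smul_tmul]
  have e2 := key 2 r2 hr2
  have e3 := key 3 r3 hr3
  linear_combination (3 * (s ⊗ₜ[A] (1 : S)) + 3 * ((1 : S) ⊗ₜ[A] s)) * e2 - 4 * e3

/-- If `S` is generated over `A` by one element `s` and `1 ⊗ s − s ⊗ 1` is nilpotent, the kernel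
of `S ⊗_A S → S` is nil (it is generated by the `1 ⊗ x − x ⊗ 1`, and the `x` with
`1 ⊗ x − x ⊗ 1 ∈ (1 ⊗ s − s ⊗ 1)` form an `A`-subalgebra containing `s`). [folklore] -/
theorem kaehlerIdeal_le_nilradical_of_adjoin_singleton (A S : Type) [CommRing A] [CommRing S]
    [Algebra A S] (s : S) (hgen : Algebra.adjoin A ({s} : Set S) = ⊤)
    (hnil : IsNilpotent ((1 : S) ⊗ₜ[A] s - s ⊗ₜ[A] (1 : S))) :
    KaehlerDifferential.ideal A S ≤ nilradical (S ⊗[A] S) := by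
  have hspan : Ideal.span {(1 : S) ⊗ₜ[A] s - s ⊗ₜ[A] (1 : S)} ≤ nilradical (S ⊗[A] S) := by
    rw [Ideal.span_le, Set.singleton_subset_iff]
    exact mem_nilradical.mpr hnil
  rw [← KaehlerDifferential.span_range_eq_ideal, Ideal.span_le]
  rintro _ ⟨x, rfl⟩
  dsimp only
  refine hspan ?_
  have hx : x ∈ Algebra.adjoin A ({s} : Set S) := hgen ▸ Algebra.mem_top
  refine Algebra.adjoin_induction
    (p := fun x _ => (1 : S) ⊗ₜ[A] x - x ⊗ₜ[A] (1 : S) ∈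
      Ideal.span {(1 : S) ⊗ₜ[A] s - s ⊗ₜ[A] (1 : S)}) ?_ ?_ ?_ ?_ hx
  · intro y hy
    rw [Set.mem_singleton_iff] at hy
    subst hy
    exact Ideal.mem_span_singleton_self _
  · intro r
    show (1 : S) ⊗ₜ[A] (algebraMap A S r) - (algebraMap A S r) ⊗ₜ[A] (1 : S) ∈ _
    rw [Algebra.algebraMap_eq_smul_one, TensorProduct.smul_tmul, sub_self]
    exact Ideal.zero_mem _
  · intro x y _ _ hx hy
    have : (1 : S) ⊗ₜ[A] (x + y) - (x + y) ⊗ₜ[A] (1 : S) =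
        ((1 : S) ⊗ₜ[A] x - x ⊗ₜ[A] 1) + ((1 : S) ⊗ₜ[A] y - y ⊗ₜ[A] 1) := by
      rw [TensorProduct.tmul_add, TensorProduct.add_tmul]; abel
    rw [this]
    exact Ideal.add_mem _ hx hy
  · intro x y _ _ hx hy
    have : (1 : S) ⊗ₜ[A] (x * y) - (x * y) ⊗ₜ[A] (1 : S) =
        ((1 : S) ⊗ₜ[A] x) * ((1 : S) ⊗ₜ[A] y - y ⊗ₜ[A] 1) +
          ((1 : S) ⊗ₜ[A] x - x ⊗ₜ[A] 1) * (y ⊗ₜ[A] (1 : S)) := by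
      simp only [mul_sub, sub_mul, Algebra.TensorProduct.tmul_mul_tmul, one_mul, mul_one]
      abel
    rw [this]
    exact Ideal.add_mem _ (Ideal.mul_mem_left _ _ hy) (Ideal.mul_mem_right _ _ hx)

/-- **Radicial covers `B[s]`, `s^p ∈ B`, are universally injective** (characteristic `p`): if
`S` is generated over `B` by one element `s` whose `p`-th power is a scalar, then
`(1 ⊗ s − s ⊗ 1)^p = 1 ⊗ s^p − s^p ⊗ 1 = 0` in `S ⊗_B S`, so `Spec S → Spec B` is universally
injective. This is the certificate provers need for `α_p`-type covers `t^p = f`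
(`Picover`, `PicoverLocalModel`). [cite: StacksProject, Tag 01S4] -/
theorem universallyInjective_SpecMap_of_pow_char_mem_range (B S : Type) [CommRing B] [CommRing S]
    [Algebra B S] (p : ℕ) [Fact p.Prime] [CharP S p] (s : S)
    (hgen : Algebra.adjoin B ({s} : Set S) = ⊤) (hs : s ^ p ∈ Set.range (algebraMap B S)) :
    UniversallyInjective (Spec.map (CommRingCat.ofHom (algebraMap B S))) := by
  refine universallyInjective_SpecMap_of_ideal_le_nilradical B S
    (kaehlerIdeal_le_nilradical_of_adjoin_singleton B S s hgen ⟨p, ?_⟩)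
  have hinj : Function.Injective
      (Algebra.TensorProduct.includeLeftRingHom : S →+* S ⊗[B] S) := by
    refine Function.HasLeftInverse.injective
      ⟨(Algebra.TensorProduct.lmul' B : S ⊗[B] S →ₐ[B] S), fun x => ?_⟩
    simp [Algebra.TensorProduct.includeLeftRingHom_apply]
  haveI : CharP (S ⊗[B] S) p := charP_of_injective_ringHom hinj p
  obtain ⟨r, hr⟩ := hs
  rw [sub_pow_char, Algebra.TensorProduct.tmul_pow, Algebra.TensorProduct.tmul_pow]
  simp only [one_pow]
  rw [← hr, Algebra.algebraMap_eq_smul_one, TensorProduct.smul_tmul, sub_self]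

/-- In particular the `α_p`-cover `Spec B[t]/(t^p − f) → Spec B` (`B` a domain of characteristic
`p`, any `f ∈ B`) is universally injective. [cite: StacksProject, Tag 01S4] -/
theorem universallyInjective_SpecMap_adjoinRoot_X_pow_char_sub_C (B : Type) [CommRing B]
    [IsDomain B] (p : ℕ) [hp : Fact p.Prime] [CharP B p] (f : B) :
    UniversallyInjective (Spec.map (CommRingCat.ofHom
      (algebraMap B (AdjoinRoot (Polynomial.X ^ p - Polynomial.C f))))) := by
  have hdeg : (Polynomial.X ^ p - Polynomial.C f : B[X]).degree ≠ 0 := by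
    rw [Polynomial.degree_X_pow_sub_C hp.out.pos]
    exact_mod_cast hp.out.ne_zero
  haveI : CharP (AdjoinRoot (Polynomial.X ^ p - Polynomial.C f)) p :=
    charP_of_injective_ringHom (AdjoinRoot.of.injective_of_degree_ne_zero hdeg) p
  refine universallyInjective_SpecMap_of_pow_char_mem_range B _ p (AdjoinRoot.root _)
    (AdjoinRoot.adjoinRoot_eq_top) ⟨f, ?_⟩
  have h0 : AdjoinRoot.mk (Polynomial.X ^ p - Polynomial.C f) (Polynomial.X ^ p - Polynomial.C f) = 0 :=
    AdjoinRoot.mk_self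
  rw [map_sub, map_pow, AdjoinRoot.mk_X, AdjoinRoot.mk_C, sub_eq_zero] at h0
  rw [AdjoinRoot.algebraMap_eq]
  exact h0.symm

section Cusp

variable (K : Type) [Field K]

/-- `T² ∈ K[T², T³]`. [folklore] -/
theorem X_sq_mem_cusp : (X ^ 2 : K[X]) ∈ Algebra.adjoin K ({X ^ 2, X ^ 3} : Set K[X]) := Algebra.subset_adjoin (by simp)

/-- `T³ ∈ K[T², T³]`. [folklore] -/
theorem X_cube_mem_cusp : (X ^ 3 : K[X]) ∈ Algebra.adjoin K ({X ^ 2, X ^ 3} : Set K[X]) := Algebra.subset_adjoin (by simp)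

/-- `T` is integral over `K[T², T³]` (`T² ∈ K[T², T³]`). [folklore] -/
theorem isIntegral_X_cusp : IsIntegral (↥(Algebra.adjoin K ({X ^ 2, X ^ 3} : Set K[X]))) (X : K[X]) := by
  refine ⟨Polynomial.X ^ 2 - Polynomial.C (⟨X ^ 2, X_sq_mem_cusp K⟩ : ↥(Algebra.adjoin K ({X ^ 2, X ^ 3} : Set K[X]))), ?_, ?_⟩
  · exact Polynomial.monic_X_pow_sub_C _ two_ne_zero
  · simp [Polynomial.eval₂_sub]

/-- `K[T]` is generated by `T` over `K[T², T³]`. [folklore] -/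
theorem adjoin_X_cusp : Algebra.adjoin (↥(Algebra.adjoin K ({X ^ 2, X ^ 3} : Set K[X]))) ({X} : Set K[X]) = ⊤ := by
  have aux : ∀ x : K[X], x ∈ Algebra.adjoin (↥(Algebra.adjoin K ({X ^ 2, X ^ 3} : Set K[X]))) ({X} : Set K[X]) := by
    intro x
    induction x using Polynomial.induction_on with
    | C c =>
        have : (C c : K[X]) = algebraMap (↥(Algebra.adjoin K ({X ^ 2, X ^ 3} : Set K[X]))) K[X] (algebraMap K (↥(Algebra.adjoin K ({X ^ 2, X ^ 3} : Set K[X]))) c) := by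
          rw [← IsScalarTower.algebraMap_apply, Polynomial.algebraMap_apply]; simp
        rw [this]
        exact Subalgebra.algebraMap_mem _ _
    | add p q hp hq => exact Subalgebra.add_mem _ hp hq
    | monomial n c ih =>
        rw [pow_succ _ n, ← mul_assoc]
        exact Subalgebra.mul_mem _ ih (Algebra.subset_adjoin rfl)
  exact eq_top_iff.mpr fun x _ => aux x

/-- `K[T]` is a finite `K[T², T³]`-module. [folklore] -/
theorem module_finite_cusp : Module.Finite (↥(Algebra.adjoin K ({X ^ 2, X ^ 3} : Set K[X]))) K[X] := by
  have h := (isIntegral_X_cusp K).fg_adjoin_singleton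
  rw [adjoin_X_cusp K, Algebra.top_toSubmodule] at h
  exact Module.finite_def.mpr h

/-- The kernel of `K[T] ⊗_{K[T²,T³]} K[T] → K[T]` is nil. [folklore] -/
theorem ideal_le_nilradical_cusp :
    KaehlerDifferential.ideal (↥(Algebra.adjoin K ({X ^ 2, X ^ 3} : Set K[X]))) K[X] ≤ nilradical (K[X] ⊗[↥(Algebra.adjoin K ({X ^ 2, X ^ 3} : Set K[X]))] K[X]) :=
  kaehlerIdeal_le_nilradical_of_adjoin_singleton (↥(Algebra.adjoin K ({X ^ 2, X ^ 3} : Set K[X]))) K[X] X (adjoin_X_cusp K)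
    ⟨3, tmul_sub_pow_three_eq_zero (↥(Algebra.adjoin K ({X ^ 2, X ^ 3} : Set K[X]))) K[X] X ⟨⟨X ^ 2, X_sq_mem_cusp K⟩, rfl⟩
      ⟨⟨X ^ 3, X_cube_mem_cusp K⟩, rfl⟩⟩

/-- The normalisation `Spec K[T] → Spec K[T², T³]` of the cuspidal cubic is universally
injective. [folklore] -/
theorem universallyInjective_cuspNormalization :
    UniversallyInjective (Spec.map (CommRingCat.ofHom (algebraMap (↥(Algebra.adjoin K ({X ^ 2, X ^ 3} : Set K[X]))) K[X]))) :=
  universallyInjective_SpecMap_of_ideal_le_nilradical (↥(Algebra.adjoin K ({X ^ 2, X ^ 3} : Set K[X]))) K[X] (ideal_le_nilradical_cusp K)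

/-- … finite. [folklore] -/
theorem isFinite_cuspNormalization :
    IsFinite (Spec.map (CommRingCat.ofHom (algebraMap (↥(Algebra.adjoin K ({X ^ 2, X ^ 3} : Set K[X]))) K[X]))) := by
  rw [IsFinite.SpecMap_iff, CommRingCat.hom_ofHom, RingHom.finite_algebraMap]
  exact module_finite_cusp K

/-- … and surjective (integral extension of domains). [folklore] -/
theorem surjective_cuspNormalization :
    Function.Surjective (Spec.map (CommRingCat.ofHom (algebraMap (↥(Algebra.adjoin K ({X ^ 2, X ^ 3} : Set K[X]))) K[X]))).base := by
  haveI := module_finite_cusp K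
  haveI : FaithfulSMul (↥(Algebra.adjoin K ({X ^ 2, X ^ 3} : Set K[X]))) K[X] :=
    (faithfulSMul_iff_algebraMap_injective (↥(Algebra.adjoin K ({X ^ 2, X ^ 3} : Set K[X]))) K[X]).mpr Subtype.val_injective
  exact Algebra.IsIntegral.comap_surjective (↥(Algebra.adjoin K ({X ^ 2, X ^ 3} : Set K[X]))) K[X]

end Cusp

end Summit.ResolutionOfSingularities.ResolutionOfSingularities.Theorems.PicoverToRadicialBottom.Negative

end
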